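import Literature.Algebra.Polynomial.CasasAlvero.Char17Digits
import Literature.Algebra.Polynomial.CasasAlvero.Degree5
import Literature.Algebra.Polynomial.CasasAlvero.Degree6
import Literature.Algebra.Polynomial.CasasAlvero.Degree8CharPMore
import Literature.Algebra.Polynomial.CasasAlvero.Degree9CharPMore
import Literature.Algebra.Polynomial.CasasAlvero.Degree11CharPMore
import Literature.Algebra.Polynomial.CasasAlvero.DigitReduction
import HarnessLib

/-!
# Casas-Alvero degrees in characteristic 17: the complete classification

Over EVERY field `K` of characteristic `17`: `CA_d(K) ⟺ d = 0 ∨ d = a·17^k` with `1 ≤ a ≤ 6`.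
Ingredients: the digit reduction `CA_d ⇒ d = a·p^k ∧ CA_a` (`DigitReduction.lean`, any field); the positive digits `1, 2, 3, 4`
([GrafVonBothmerEtAl2007, Props. 2, 6]), `5` (`Degree5.lean`) and `6` (`Degree6.lean`: `17` is a GOOD prime for degree `6` —
[CastryckLaterveerOunaies2012, Thm. 4], re-proved there by kernel-checked elimination certificates — and `CA_{6·p^k}` descends from
the algebraic closure); and a refutation of every digit `7 ≤ a ≤ 16` over every field of characteristic `17`:
`7, 10, 13, 16` by the binomial criterion (`binom(a,m) ≡ 1 (mod 17)`, `m = 3, 3, 4, 2`), `8, 9, 11` by the explicit examples of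
`Degree8CharPMore.lean`, `Degree9CharPMore.lean`, `Degree11CharPMore.lean`, and `12, 14, 15` by the trinomials of `Char17Digits.lean`.
-/

noncomputable section

open Polynomial

namespace Literature.Algebra.Polynomial.CasasAlvero

variable (K : Type*) [Field K] [CharP K 17]

/-- every digit `7 ≤ a < 17` fails: `¬ CA_a` over every field of characteristic `17`. [folklore] -/
theorem not_holdsInDegree_digit_of_char_seventeen {a : ℕ} (h7 : 7 ≤ a) (hap : a < 17) : ¬ HoldsInDegree K a := by
  haveI : Fact (Nat.Prime 17) := ⟨by norm_num⟩
  interval_cases a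
  · exact not_holdsInDegree_of_choose_modEq_one K 17 (d := 7) (m := 3) (by norm_num) (by norm_num) (by decide)
  · exact not_holdsInDegree_eight_of_char_17 K
  · exact not_holdsInDegree_nine_of_char_17 K
  · exact not_holdsInDegree_of_choose_modEq_one K 17 (d := 10) (m := 3) (by norm_num) (by norm_num) (by decide)
  · exact not_holdsInDegree_eleven_of_char_17 K
  · exact not_holdsInDegree_twelve_of_char_17 K
  · exact not_holdsInDegree_of_choose_modEq_one K 17 (d := 13) (m := 4) (by norm_num) (by norm_num) (by decide)
  · exact not_holdsInDegree_fourteen_of_char_17 K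
  · exact not_holdsInDegree_fifteen_of_char_17 K
  · exact not_holdsInDegree_of_choose_modEq_one K 17 (d := 16) (m := 2) (by norm_num) (by norm_num) (by decide)

/-- the positive digits `1 ≤ a ≤ 5`: `CA_{a·17^k}` over every field of characteristic `17`. [cite: GrafVonBothmerEtAl2007, Props. 2, 6]
[cite: CastryckLaterveerOunaies2012, Thm. 4] -/
theorem holdsInDegree_mul_seventeen_pow_of_le_five {a : ℕ} (ha0 : 0 < a) (ha5 : a ≤ 5) (k : ℕ) :
    HoldsInDegree K (a * 17 ^ k) := by
  haveI : Fact (Nat.Prime 17) := ⟨by norm_num⟩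
  interval_cases a
  · simpa using holdsInDegree_prime_pow_field K 17 k
  · exact holdsInDegree_two_mul_prime_pow_field K 17 k
  · exact holdsInDegree_three_mul_prime_pow_field K 17 (by norm_num) k
  · exact holdsInDegree_mul_prime_pow_field K 17
      (holdsInDegree_of_le_four_of_charP (AlgebraicClosure K) 17 (by norm_num) le_rfl) k
  · exact holdsInDegree_five_mul_prime_pow_field K 17 (by norm_num) (by norm_num) (by norm_num) (by norm_num)
      (by norm_num) (by norm_num) (by norm_num) (by norm_num) (by norm_num) k

/-- **characteristic 17, complete**: over every field of characteristic `17`,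
`CA_d ⟺ d = 0 ∨ d = a·17^k` with `1 ≤ a ≤ 6`. [cite: GrafVonBothmerEtAl2007, Props. 2, 6, 7]
[cite: CastryckLaterveerOunaies2012, Thm. 4] -/
theorem classification_char_seventeen_complete (d : ℕ) :
    HoldsInDegree K d ↔ d = 0 ∨ ∃ k a : ℕ, 0 < a ∧ a ≤ 6 ∧ d = a * 17 ^ k := by
  haveI : Fact (Nat.Prime 17) := ⟨by norm_num⟩
  constructor
  · intro h
    rcases Nat.eq_zero_or_pos d with rfl | hd
    · exact Or.inl rfl
    obtain ⟨k, a, ha0, hap, rfl, ha⟩ := digit_of_holdsInDegree K 17 hd.ne' h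
    refine Or.inr ⟨k, a, ha0, ?_, rfl⟩
    by_contra h6
    exact not_holdsInDegree_digit_of_char_seventeen K (by omega) hap ha
  · rintro (rfl | ⟨k, a, ha0, ha6, rfl⟩)
    · exact holdsInDegree_zero K
    · rcases Nat.lt_or_ge a 6 with ha | ha
      · exact holdsInDegree_mul_seventeen_pow_of_le_five K ha0 (by omega) k
      · obtain rfl : a = 6 := le_antisymm ha6 ha
        exact holdsInDegree_six_mul_pow_of_char_17 K k

/-- the set of Casas-Alvero degrees `≤ 289` in characteristic `17`, explicitly. [folklore] -/
theorem holdsInDegree_iff_mem_of_le_char_seventeen_sq {d : ℕ} (hd : d ≤ 289) :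
    HoldsInDegree K d ↔ d ∈ ({0, 1, 2, 3, 4, 5, 6, 17, 34, 51, 68, 85, 102, 289} : Finset ℕ) := by
  rw [classification_char_seventeen_complete]
  constructor
  · rintro (rfl | ⟨k, a, ha0, ha6, rfl⟩)
    · decide
    · rcases k with _ | _ | _ | k
      · interval_cases a <;> decide
      · interval_cases a <;> decide
      · interval_cases a <;> simp_all
      · exfalso
        have : 17 ^ 3 ≤ a * 17 ^ (k + 1 + 1 + 1) :=
          le_trans (Nat.pow_le_pow_right (by norm_num) (by omega)) (Nat.le_mul_of_pos_left _ ha0)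
        omega
  · intro h
    simp only [Finset.mem_insert, Finset.mem_singleton] at h
    rcases h with rfl | rfl | rfl | rfl | rfl | rfl | rfl | rfl | rfl | rfl | rfl | rfl | rfl | rfl
    · exact Or.inl rfl
    · exact Or.inr ⟨0, 1, by norm_num, by norm_num, by norm_num⟩
    · exact Or.inr ⟨0, 2, by norm_num, by norm_num, by norm_num⟩
    · exact Or.inr ⟨0, 3, by norm_num, by norm_num, by norm_num⟩
    · exact Or.inr ⟨0, 4, by norm_num, by norm_num, by norm_num⟩
    · exact Or.inr ⟨0, 5, by norm_num, by norm_num, by norm_num⟩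
    · exact Or.inr ⟨0, 6, by norm_num, by norm_num, by norm_num⟩
    · exact Or.inr ⟨1, 1, by norm_num, by norm_num, by norm_num⟩
    · exact Or.inr ⟨1, 2, by norm_num, by norm_num, by norm_num⟩
    · exact Or.inr ⟨1, 3, by norm_num, by norm_num, by norm_num⟩
    · exact Or.inr ⟨1, 4, by norm_num, by norm_num, by norm_num⟩
    · exact Or.inr ⟨1, 5, by norm_num, by norm_num, by norm_num⟩
    · exact Or.inr ⟨1, 6, by norm_num, by norm_num, by norm_num⟩
    · exact Or.inr ⟨2, 1, by norm_num, by norm_num, by norm_num⟩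

end Literature.Algebra.Polynomial.CasasAlvero
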